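import Summits.CriticalPhenomena.CardyFormulaZ2.Theses.PivotalEnergyLaw
import Literature.Probability.RandomPlanarGeometry.ImageUnivalent
import Literature.Analysis.Complex.InjectiveHolomorphic

/-!
# Birth skeleton (BC3) for crux `ConformalDilationCovariance` (stmt-CriticalPhenomena-4705)

Route `PivotalEnergyLaw` (route-CriticalPhenomena-PivotalEnergyLaw), sub-problem `CardyFormulaZ2`,
summit `CriticalPhenomena`; crux rank 2 = the route's thesis X. Registrar: planner
`skel-stmt-CriticalPhenomena-4705` (2026-08-17, BC3 of `run/shared/lean/lens3/_common/BC.md`).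
Tree path `Summits/CriticalPhenomena/CardyFormulaZ2/Cruxes/ConformalDilationCovariance/Lines/birth.lean`.

The crux (route decl, FIXED): for `φ` holomorphic and injective on an open `U ⊇ closedBall c ρ`,
`p ∈ ball c ρ`, marks at angles `θ 0 < θ 1 < θ 2 < θ 3 < θ 0 + 2π` and `s, t ∈ (0,1]`, any conformal
rectangles `R`, `R'` presenting the BLOW-UP QUADS `φ (ball (p + s(c-p)) (sρ))` (marks
`φ (p + s(yᵢ - p))`, `yᵢ = c + ρ e^{iθᵢ}`) resp. the `t`-versions satisfy
`bondDomainCrossingProb R (sδ) - bondDomainCrossingProb R' (tδ) → 0` as `δ → 0⁺`.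

## The line: compare `φ` with its 1-jet at the blow-up centre (two registered stubs)

The blow-up discs `D_s := ball (p + s(c-p)) (sρ) = p + s(D - p)` are homothetic about `p`, all
contain `p`, and all lie in `closedBall c ρ ⊆ U`. Let `A(z) := φ p + φ'(p)(z - p)` be the 1-jet
(tangent similarity) of `φ` at `p`; `φ'(p) ≠ 0` by univalence
(`Literature.Analysis.Complex.SCV.deriv_ne_zero_of_injOn`, in the tree).

* `stub_tangentModelCovariance` (the OPEN HEART, conformal-invariance strength, size XL): for a map
  univalent near a closed disc `D̄` and ANY interior point `p ∈ D`, the bond-`ℤ²` crossing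
  probabilities of the analytic quad `φ(D)` (marks `φ(yᵢ)`) and of its tangent model `A(D)` (a ROUND
  marked disc, marks `A(yᵢ)`) are asymptotically equal AT THE SAME MESH `δ → 0⁺`. No blow-up path, no
  mesh change: this is the path-free, local form of the route's energy law ("an analytic quad has the
  crossing probabilities of its first-order model at any interior point"); for `φ(z) = λz` it is
  EMPTY (A = φ), so it does not contain scale invariance at fixed mesh (the log-scale oscillation the
  route header warns about). It is a consequence of `CardyFormulaZ2` (`φ ∘ A⁻¹` is a conformal map of
  marked domains, same cross-ratio). Why it might fail: exactly the crux's recorded risk — a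
  subsequential limit of bond-`ℤ²` quad crossings that is not conformally covariant
  (barrier `EmbeddingModulusUniqueness`: the statement refers to the square embedding through
  `deriv φ p`, a EUCLIDEAN similarity, so it is not shear-blind).
* `stub_affineDilationCovariance` (known technology, size M–L): the crux itself for the
  NON-DEGENERATE AFFINE maps `z ↦ b + a(z - p)` — the special case the crux's docstring singles out
  ("φ affine gives translation invariance"). After the exact lattice scaling
  `(Ω, δ) ↦ (s⁻¹Ω, s⁻¹·)` the two quads are TRANSLATES of one round marked disc read at the same
  mesh, so the content is asymptotic translation invariance of disc crossing probabilities
  (lattice translations are exact; the sub-mesh jitter `|w - δ[w/δ]| ≤ δ` is RSW / half-plane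
  three-arm continuity under `O(δ)` boundary perturbations: Schramm–Smirnov 2011 §5,
  Grimmett 1999 §11.7; `rsw_half_holds` in the tree). Why it might fail: only through the
  discretisation bookkeeping (largest component / closest-arc rule of G02) at mesh-scale
  perturbations near the four marks.

Composition `ConformalDilationCovariance_of` (real proof, no `sorry`): present the tangent-model
quads `A(D_s)`, `A(D_t)` (a marked round disc `markedDisc`, constructed here with all fields proved,
pushed through `A` by `ConformalRectangle.exists_image`); `stub_tangentModelCovariance` at the discs
`D_s ∋ p` and `D_t ∋ p` gives `P(R, ·) - P(A(D_s), ·) → 0` and `P(R', ·) - P(A(D_t), ·) → 0`, which we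
read along `δ ↦ sδ`, `δ ↦ tδ`; `stub_affineDilationCovariance` with `a = φ'(p)`, `b = φ(p)` gives
`P(A(D_s), sδ) - P(A(D_t), tδ) → 0`; add the three.

`lean check --json`: rc 0, sorries 2 = the two `stub_*`, zero elsewhere (see the registrar's
NOTES.md for the raw audit and the BC3 probe outputs: for each stub, `stub → ConformalDilationCovariance`
and `stub → CardyFormulaZ2` by `exact?` · `simpa` · `aesop` FAIL).

Disproof used: none on file (`ledger crux ls stmt-CriticalPhenomena-4705`: no workfiles, no
`Disproof.lean`, at registration). Negatives index (11 entries, 2026-08-17): no stub is an instance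
of a refuted statement (stmt-0748 `NegDegenerateArcs` concerns crossing probabilities hitting `0`;
both stubs are difference statements about genuine marked Jordan domains). Dead lines: none.
-/

noncomputable section

namespace Summit.CriticalPhenomena.CardyFormulaZ2.Cruxes.ConformalDilationCovariance.Birth

open scoped Topology
open Set Filter
open Literature.Probability.RandomPlanarGeometry Literature.Probability.Percolation
open Summit.CriticalPhenomena.CardyFormulaZ2.Theses.PivotalEnergyLaw (ConformalDilationCovariance)

/-! ### Registered stubs (the ONLY `sorry`s of this file) -/

/-- **S1 `stub_tangentModelCovariance`** (open heart, size XL). For `φ` holomorphic and injective on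
an open `U ⊇ closedBall c ρ`, an interior point `p ∈ ball c ρ` and marks at angles
`θ 0 < θ 1 < θ 2 < θ 3 < θ 0 + 2π`: any `R` presenting the analytic quad `φ(ball c ρ)` with marks
`φ(c + ρe^{iθᵢ})` and any `R₁` presenting its TANGENT MODEL at `p`, the round marked disc
`A(ball c ρ)`, `A(z) = φ p + deriv φ p · (z - p)`, with marks `A(c + ρe^{iθᵢ})`, have
`bondDomainCrossingProb R δ - bondDomainCrossingProb R₁ δ → 0` as `δ → 0⁺` (same mesh on both sides).
Conformal-invariance content of the crux in path-free local form; a consequence of `CardyFormulaZ2`. -/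
theorem stub_tangentModelCovariance :
    ∀ (U : Set ℂ) (φ : ℂ → ℂ) (c p : ℂ) (ρ : ℝ) (θ : Fin 4 → ℝ), IsOpen U →
      DifferentiableOn ℂ φ U → Set.InjOn φ U → 0 < ρ → Metric.closedBall c ρ ⊆ U →
      p ∈ Metric.ball c ρ → StrictMono θ → θ 3 < θ 0 + 2 * Real.pi →
      ∀ R R₁ : Literature.Probability.RandomPlanarGeometry.ConformalRectangle,
        (R.carrier = φ '' Metric.ball c ρ ∧
          ∀ i, R.pt i = φ (c + ρ * Complex.exp (Complex.I * θ i))) →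
        (R₁.carrier = (fun z => φ p + deriv φ p * (z - p)) '' Metric.ball c ρ ∧
          ∀ i, R₁.pt i = φ p + deriv φ p * (c + ρ * Complex.exp (Complex.I * θ i) - p)) →
        Filter.Tendsto
          (fun δ : ℝ => Literature.Probability.Percolation.bondDomainCrossingProb R δ -
            Literature.Probability.Percolation.bondDomainCrossingProb R₁ δ)
          (nhdsWithin 0 (Set.Ioi 0)) (nhds 0) := by
  sorry

/-- **S2 `stub_affineDilationCovariance`** (known technology, size M–L). The crux for the
non-degenerate AFFINE maps `φ(z) = b + a(z - p)`, `a ≠ 0`: the blow-up quads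
`b + s·a(ball c ρ - p)` read at mesh `sδ` and `b + t·a(ball c ρ - p)` read at mesh `tδ` have
asymptotically equal bond-`ℤ²` crossing probabilities. After exact lattice scaling the two are
translates of one round marked disc at the same mesh: asymptotic translation invariance
(RSW / half-plane three-arm continuity under `O(δ)` boundary perturbations). -/
theorem stub_affineDilationCovariance :
    ∀ (a b c p : ℂ) (ρ : ℝ) (θ : Fin 4 → ℝ), a ≠ 0 → 0 < ρ → p ∈ Metric.ball c ρ →
      StrictMono θ → θ 3 < θ 0 + 2 * Real.pi →
      ∀ s t : ℝ, s ∈ Set.Ioc (0:ℝ) 1 → t ∈ Set.Ioc (0:ℝ) 1 →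
      ∀ R R' : Literature.Probability.RandomPlanarGeometry.ConformalRectangle,
        (R.carrier = (fun z => b + a * (z - p)) '' Metric.ball (p + s * (c - p)) (s * ρ) ∧
          ∀ i, R.pt i = b + a * (p + s * (c + ρ * Complex.exp (Complex.I * θ i) - p) - p)) →
        (R'.carrier = (fun z => b + a * (z - p)) '' Metric.ball (p + t * (c - p)) (t * ρ) ∧
          ∀ i, R'.pt i = b + a * (p + t * (c + ρ * Complex.exp (Complex.I * θ i) - p) - p)) →
        Filter.Tendsto
          (fun δ : ℝ => Literature.Probability.Percolation.bondDomainCrossingProb R (s * δ) -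
            Literature.Probability.Percolation.bondDomainCrossingProb R' (t * δ))
          (nhdsWithin 0 (Set.Ioi 0)) (nhds 0) := by
  sorry

/-! ### Name-keyed aliases of the two statements

The hypotheses of the composition: the skeleton audit admits a hypothesis only if its head
constant is named like a declared stub. Each alias repeats the stub's signature verbatim (the
wiring `example` at the end checks that they agree). -/
namespace Registered

/-- Statement of `stub_tangentModelCovariance` (S1), keyed by the registered stub name. -/
abbrev stub_tangentModelCovariance : Prop :=
  ∀ (U : Set ℂ) (φ : ℂ → ℂ) (c p : ℂ) (ρ : ℝ) (θ : Fin 4 → ℝ), IsOpen U →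
    DifferentiableOn ℂ φ U → Set.InjOn φ U → 0 < ρ → Metric.closedBall c ρ ⊆ U →
    p ∈ Metric.ball c ρ → StrictMono θ → θ 3 < θ 0 + 2 * Real.pi →
    ∀ R R₁ : Literature.Probability.RandomPlanarGeometry.ConformalRectangle,
      (R.carrier = φ '' Metric.ball c ρ ∧
        ∀ i, R.pt i = φ (c + ρ * Complex.exp (Complex.I * θ i))) →
      (R₁.carrier = (fun z => φ p + deriv φ p * (z - p)) '' Metric.ball c ρ ∧
        ∀ i, R₁.pt i = φ p + deriv φ p * (c + ρ * Complex.exp (Complex.I * θ i) - p)) →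
      Filter.Tendsto
        (fun δ : ℝ => Literature.Probability.Percolation.bondDomainCrossingProb R δ -
          Literature.Probability.Percolation.bondDomainCrossingProb R₁ δ)
        (nhdsWithin 0 (Set.Ioi 0)) (nhds 0)

/-- Statement of `stub_affineDilationCovariance` (S2), keyed by the registered stub name. -/
abbrev stub_affineDilationCovariance : Prop :=
  ∀ (a b c p : ℂ) (ρ : ℝ) (θ : Fin 4 → ℝ), a ≠ 0 → 0 < ρ → p ∈ Metric.ball c ρ →
    StrictMono θ → θ 3 < θ 0 + 2 * Real.pi →
    ∀ s t : ℝ, s ∈ Set.Ioc (0:ℝ) 1 → t ∈ Set.Ioc (0:ℝ) 1 →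
    ∀ R R' : Literature.Probability.RandomPlanarGeometry.ConformalRectangle,
      (R.carrier = (fun z => b + a * (z - p)) '' Metric.ball (p + s * (c - p)) (s * ρ) ∧
        ∀ i, R.pt i = b + a * (p + s * (c + ρ * Complex.exp (Complex.I * θ i) - p) - p)) →
      (R'.carrier = (fun z => b + a * (z - p)) '' Metric.ball (p + t * (c - p)) (t * ρ) ∧
        ∀ i, R'.pt i = b + a * (p + t * (c + ρ * Complex.exp (Complex.I * θ i) - p) - p)) →
      Filter.Tendsto
        (fun δ : ℝ => Literature.Probability.Percolation.bondDomainCrossingProb R (s * δ) -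
          Literature.Probability.Percolation.bondDomainCrossingProb R' (t * δ))
        (nhdsWithin 0 (Set.Ioi 0)) (nhds 0)

end Registered

/-! ### A round marked disc as a conformal rectangle (all fields proved) -/

/-- The round disc `ball c ρ` marked at the four points `c + ρe^{iθᵢ}`, for angles
`θ 0 < θ 1 < θ 2 < θ 3 < θ 0 + 2π`: boundary loop `t ↦ c + ρe^{i(2πt + θ₀)}`, marks
`(θᵢ - θ₀)/(2π) ∈ [0,1)`. (Cf. `JordanDomain.rotUnitDisc` of `DiscRectangles`.) -/
def markedDisc (c : ℂ) (ρ : ℝ) (hρ : 0 < ρ) (θ : Fin 4 → ℝ) (hθ : StrictMono θ)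
    (hθ' : θ 3 < θ 0 + 2 * Real.pi) :
    Literature.Probability.RandomPlanarGeometry.ConformalRectangle where
  carrier := Metric.ball c ρ
  boundary u := circleMap c ρ (2 * Real.pi * u + θ 0)
  isOpen := Metric.isOpen_ball
  isBounded := Metric.isBounded_ball
  isConnected := ((convex_ball c ρ).isPathConnected (Metric.nonempty_ball.2 hρ)).isConnected
  continuous_boundary := (continuous_circleMap c ρ).comp (by fun_prop)
  periodic_boundary u := by
    simp only
    rw [show 2 * Real.pi * (u + 1) + θ 0 = 2 * Real.pi * u + θ 0 + 2 * Real.pi by ring]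
    exact periodic_circleMap c ρ _
  injOn_boundary := by
    intro u hu v hv h
    have hinj := injOn_circleMap_of_abs_sub_le' (c := c) (a := θ 0) (b := θ 0 + 2 * Real.pi)
      hρ.ne' (by linarith)
    have key : 2 * Real.pi * u + θ 0 = 2 * Real.pi * v + θ 0 :=
      hinj ⟨by nlinarith [Real.pi_pos, hu.1], by nlinarith [Real.pi_pos, hu.2]⟩
        ⟨by nlinarith [Real.pi_pos, hv.1], by nlinarith [Real.pi_pos, hv.2]⟩ h
    have : 2 * Real.pi * u = 2 * Real.pi * v := by linarith
    exact mul_left_cancel₀ (by positivity) this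
  range_boundary := by
    have hs : Function.Surjective fun u : ℝ ↦ 2 * Real.pi * u + θ 0 := fun y ↦
      ⟨(y - θ 0) / (2 * Real.pi), by field_simp; ring⟩
    rw [frontier_ball _ hρ.ne', show (fun u : ℝ ↦ circleMap c ρ (2 * Real.pi * u + θ 0)) =
      circleMap c ρ ∘ fun u : ℝ ↦ 2 * Real.pi * u + θ 0 from rfl, hs.range_comp, range_circleMap,
      abs_of_pos hρ]
  mark i := (θ i - θ 0) / (2 * Real.pi)
  strictMono_mark i j hij := div_lt_div_of_pos_right (by linarith [hθ hij]) (by positivity)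
  mark_mem i := by
    have h0 : θ 0 ≤ θ i := hθ.monotone (Fin.zero_le i)
    have h3 : θ i ≤ θ 3 := hθ.monotone (Fin.le_last i)
    constructor
    · exact div_nonneg (by linarith) (by positivity)
    · rw [div_lt_one (by positivity)]
      linarith

/-- The marked points of `markedDisc c ρ θ` are `c + ρ e^{iθᵢ}`. -/
theorem markedDisc_pt (c : ℂ) (ρ : ℝ) (hρ : 0 < ρ) (θ : Fin 4 → ℝ) (hθ : StrictMono θ)
    (hθ' : θ 3 < θ 0 + 2 * Real.pi) (i : Fin 4) :
    (markedDisc c ρ hρ θ hθ hθ').pt i = c + ρ * Complex.exp (Complex.I * θ i) := by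
  have h2 : 2 * Real.pi * ((θ i - θ 0) / (2 * Real.pi)) + θ 0 = θ i := by
    field_simp
    ring
  show circleMap c ρ (2 * Real.pi * ((θ i - θ 0) / (2 * Real.pi)) + θ 0) = _
  rw [h2]
  simp only [circleMap]
  rw [mul_comm Complex.I]

/-- Presentations of the AFFINE IMAGE of a round marked disc exist, in the shape of the stub
hypotheses: carrier `A '' ball c ρ`, marks `A (c + ρe^{iθᵢ})`, `A z = b + a(z - p)`, `a ≠ 0`
(`markedDisc` pushed through `A` by `ConformalRectangle.exists_image`). -/
theorem exists_affine_markedDisc (a b p c : ℂ) (ρ : ℝ) (θ : Fin 4 → ℝ) (ha : a ≠ 0)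
    (hρ : 0 < ρ) (hθ : StrictMono θ) (hθ' : θ 3 < θ 0 + 2 * Real.pi) :
    ∃ S : Literature.Probability.RandomPlanarGeometry.ConformalRectangle,
      S.carrier = (fun z => b + a * (z - p)) '' Metric.ball c ρ ∧
        ∀ i, S.pt i = b + a * (c + ρ * Complex.exp (Complex.I * θ i) - p) := by
  have hcont : ContinuousOn (fun z : ℂ => b + a * (z - p))
      (closure (markedDisc c ρ hρ θ hθ hθ').carrier) :=
    (by fun_prop : Continuous fun z : ℂ => b + a * (z - p)).continuousOn
  have hinj : Set.InjOn (fun z : ℂ => b + a * (z - p))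
      (closure (markedDisc c ρ hρ θ hθ hθ').carrier) := by
    intro x _ y _ hxy
    have h1 : a * (x - p) = a * (y - p) := add_left_cancel hxy
    have h2 : x - p = y - p := mul_left_cancel₀ ha h1
    exact sub_left_inj.mp h2
  obtain ⟨S, hS, hSpt⟩ :=
    ConformalRectangle.exists_image (markedDisc c ρ hρ θ hθ hθ') (fun z => b + a * (z - p)) hcont hinj
  refine ⟨S, hS, fun i => ?_⟩
  rw [hSpt i, markedDisc_pt]

/-! ### Elementary facts about the blow-up discs `D_r = ball (p + r(c - p)) (rρ)` -/

/-- For `p ∈ ball c ρ` and `r ∈ (0,1]`, the blow-up disc `closedBall (p + r(c-p)) (rρ)` lies in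
`closedBall c ρ`. -/
theorem closedBall_blowup_subset {c p : ℂ} {ρ r : ℝ} (hp : p ∈ Metric.ball c ρ)
    (hr : r ∈ Set.Ioc (0:ℝ) 1) :
    Metric.closedBall (p + r * (c - p)) (r * ρ) ⊆ Metric.closedBall c ρ := by
  intro z hz
  rw [Metric.mem_closedBall] at hz ⊢
  rw [Metric.mem_ball] at hp
  have h1 : dist (p + r * (c - p)) c = (1 - r) * dist p c := by
    rw [dist_eq_norm, dist_eq_norm,
      show p + (r : ℂ) * (c - p) - c = ((1 - r : ℝ) : ℂ) * (p - c) by push_cast; ring,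
      norm_mul, Complex.norm_real, Real.norm_eq_abs, abs_of_nonneg (by linarith [hr.2])]
  calc dist z c ≤ dist z (p + r * (c - p)) + dist (p + r * (c - p)) c := dist_triangle _ _ _
    _ ≤ r * ρ + (1 - r) * dist p c := by rw [h1]; linarith
    _ ≤ r * ρ + (1 - r) * ρ := by
        have : 0 ≤ 1 - r := by linarith [hr.2]
        nlinarith
    _ = ρ := by ring

/-- For `p ∈ ball c ρ` and `r > 0`, the point `p` lies in the blow-up disc
`ball (p + r(c-p)) (rρ)`. -/
theorem mem_ball_blowup {c p : ℂ} {ρ r : ℝ} (hp : p ∈ Metric.ball c ρ) (hr : 0 < r) :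
    p ∈ Metric.ball (p + r * (c - p)) (r * ρ) := by
  rw [Metric.mem_ball] at hp ⊢
  rw [dist_comm] at hp
  rw [dist_eq_norm, show p - (p + (r : ℂ) * (c - p)) = -((r : ℂ) * (c - p)) by ring, norm_neg,
    norm_mul, Complex.norm_real, Real.norm_eq_abs, abs_of_pos hr, ← dist_eq_norm]
  exact mul_lt_mul_of_pos_left hp hr

/-- Multiplication by a positive constant maps `𝓝[>] 0` to itself. -/
theorem tendsto_const_mul_nhdsWithin_zero {s : ℝ} (hs : 0 < s) :
    Filter.Tendsto (fun δ : ℝ => s * δ) (nhdsWithin 0 (Set.Ioi 0)) (nhdsWithin 0 (Set.Ioi 0)) := by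
  refine tendsto_nhdsWithin_iff.2 ⟨?_, ?_⟩
  · have h : Filter.Tendsto (fun δ : ℝ => s * δ) (nhds 0) (nhds (s * 0)) :=
      (continuous_const.mul continuous_id).tendsto 0
    rw [mul_zero] at h
    exact h.mono_left nhdsWithin_le_nhds
  · exact eventually_mem_nhdsWithin.mono fun δ hδ => mul_pos hs hδ

/-! ### The composition: the two stubs imply the crux, by name -/

/-- **`ConformalDilationCovariance` from S1 and S2** (no `sorry`). Given the data of the crux and
`s, t ∈ (0,1]`: `deriv φ p ≠ 0` (univalence, `SCV.deriv_ne_zero_of_injOn`); present the tangent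
models `A(D_s)`, `A(D_t)` of the blow-up discs `D_r = ball (p + r(c-p)) (rρ) ∋ p`
(`exists_affine_markedDisc`); S1 at the discs `D_s`, `D_t` compares `R`, `R'` with them at the same
mesh, read along `δ ↦ sδ`, `δ ↦ tδ`; S2 (the crux for the affine map `A`) compares the two tangent
models across the mesh change; the three differences add up. -/
theorem ConformalDilationCovariance_of (h₁ : Registered.stub_tangentModelCovariance)
    (h₂ : Registered.stub_affineDilationCovariance) :
    Summit.CriticalPhenomena.CardyFormulaZ2.Theses.PivotalEnergyLaw.ConformalDilationCovariance := by
  intro U φ c p ρ θ hU hφ hinj hρ hsub hp hθ hθ' s t hs ht R R' hR hR'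
  -- the 1-jet of `φ` at the blow-up centre is a non-degenerate similarity
  have ha : deriv φ p ≠ 0 :=
    Literature.Analysis.Complex.SCV.deriv_ne_zero_of_injOn hφ hU hinj
      (hsub (Metric.ball_subset_closedBall hp))
  -- the blow-up discs
  have hsub_s : Metric.closedBall (p + s * (c - p)) (s * ρ) ⊆ U :=
    (closedBall_blowup_subset hp hs).trans hsub
  have hsub_t : Metric.closedBall (p + t * (c - p)) (t * ρ) ⊆ U :=
    (closedBall_blowup_subset hp ht).trans hsub
  have hp_s : p ∈ Metric.ball (p + s * (c - p)) (s * ρ) := mem_ball_blowup hp hs.1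
  have hp_t : p ∈ Metric.ball (p + t * (c - p)) (t * ρ) := mem_ball_blowup hp ht.1
  have hρs : 0 < s * ρ := mul_pos hs.1 hρ
  have hρt : 0 < t * ρ := mul_pos ht.1 hρ
  -- presentations of the tangent models of the two blow-up quads
  obtain ⟨S, hSc, hSp⟩ :=
    exists_affine_markedDisc (deriv φ p) (φ p) p (p + s * (c - p)) (s * ρ) θ ha hρs hθ hθ'
  obtain ⟨S', hS'c, hS'p⟩ :=
    exists_affine_markedDisc (deriv φ p) (φ p) p (p + t * (c - p)) (t * ρ) θ ha hρt hθ hθ'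
  -- the marks of `R`, `R'` rewritten at the blow-up discs
  have hRp : ∀ i, R.pt i = φ (p + s * (c - p) + (s * ρ : ℝ) * Complex.exp (Complex.I * θ i)) := by
    intro i
    rw [hR.2 i]
    congr 1
    push_cast
    ring
  have hR'p : ∀ i, R'.pt i = φ (p + t * (c - p) + (t * ρ : ℝ) * Complex.exp (Complex.I * θ i)) := by
    intro i
    rw [hR'.2 i]
    congr 1
    push_cast
    ring
  -- S1 at the disc `D_s ∋ p` and at the disc `D_t ∋ p`
  have e₁ : Filter.Tendsto (fun δ : ℝ => bondDomainCrossingProb R δ - bondDomainCrossingProb S δ)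
      (nhdsWithin 0 (Set.Ioi 0)) (nhds 0) :=
    h₁ U φ (p + s * (c - p)) p (s * ρ) θ hU hφ hinj hρs hsub_s hp_s hθ hθ' R S ⟨hR.1, hRp⟩
      ⟨hSc, hSp⟩
  have e₃ : Filter.Tendsto (fun δ : ℝ => bondDomainCrossingProb R' δ - bondDomainCrossingProb S' δ)
      (nhdsWithin 0 (Set.Ioi 0)) (nhds 0) :=
    h₁ U φ (p + t * (c - p)) p (t * ρ) θ hU hφ hinj hρt hsub_t hp_t hθ hθ' R' S' ⟨hR'.1, hR'p⟩
      ⟨hS'c, hS'p⟩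
  -- the marks of the tangent models rewritten in the blow-up form of S2
  have hSp' : ∀ i, S.pt i =
      φ p + deriv φ p * (p + s * (c + ρ * Complex.exp (Complex.I * θ i) - p) - p) := by
    intro i
    rw [hSp i]
    push_cast
    ring
  have hS'p' : ∀ i, S'.pt i =
      φ p + deriv φ p * (p + t * (c + ρ * Complex.exp (Complex.I * θ i) - p) - p) := by
    intro i
    rw [hS'p i]
    push_cast
    ring
  -- S2: the crux for the affine map `A`
  have e₂ : Filter.Tendsto
      (fun δ : ℝ => bondDomainCrossingProb S (s * δ) - bondDomainCrossingProb S' (t * δ))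
      (nhdsWithin 0 (Set.Ioi 0)) (nhds 0) :=
    h₂ (deriv φ p) (φ p) c p ρ θ ha hρ hp hθ hθ' s t hs ht S S' ⟨hSc, hSp'⟩ ⟨hS'c, hS'p'⟩
  -- read S1 along `δ ↦ sδ` and `δ ↦ tδ`, and add up
  have E₁ := e₁.comp (tendsto_const_mul_nhdsWithin_zero hs.1)
  have E₃ := e₃.comp (tendsto_const_mul_nhdsWithin_zero ht.1)
  have key := (E₁.add e₂).sub E₃
  rw [add_zero, sub_zero] at key
  refine key.congr fun δ => ?_
  simp only [Function.comp_apply]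
  ring

/-- Wiring check: the registered (sorried) stubs feed `ConformalDilationCovariance_of` exactly as
stated (so the `Registered` aliases agree with the stub signatures). An `example`, so that
`ConformalDilationCovariance_of` stays the only named theorem of this file concluding the crux. -/
example : Summit.CriticalPhenomena.CardyFormulaZ2.Theses.PivotalEnergyLaw.ConformalDilationCovariance :=
  ConformalDilationCovariance_of stub_tangentModelCovariance stub_affineDilationCovariance

end Summit.CriticalPhenomena.CardyFormulaZ2.Cruxes.ConformalDilationCovariance.Birth

end
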